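import Mathlib
import Literature.Analysis.FluidPDE.TaoEnstrophyLocalisation
import Literature.Analysis.FluidPDE.VectorCalculus
import Literature.Analysis.FunctionSpaces.SobolevDomain
import Summits.NavierStokesRegularity.NavierStokesRegularity.Theorems.EulerZoomLiouvillePowerGaugeEulerLiouvilleWeakConfinedVorticityIntrinsic
import Summits.NavierStokesRegularity.NavierStokesRegularity.Theorems.EulerZoomLiouvillePowerGaugeEulerLiouvilleWeakIntegrableVorticityTools
import HarnessLib

/-!
# Crux `EulerZoomLiouville.PowerGaugeEulerLiouville` (stmt-NavierStokesRegularity-19832), weak stratum, lines `weak_eulerian` (E1) /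
# `weak_axisym` (X0): tools for the WEAK VORTICITY EQUATION — curl algebra, the curl test fields `curl(ψ•e)`, the weak curl transfer

Route №10 `EulerZoomLiouville` (NavierStokesRegularity), crux E = stmt-NavierStokesRegularity-19832; width seat ns-ezl-w1 g9 under the LEAD ns-typeII-p2.
First-order calculus for `stub_weakVorticityEquation` (the profile equation tested with `Ψ = curl(ψ•e)`):

* `inner_curlCLM_smulRight_eq`, `sum_inner_apply_crossBasis_eq` — coordinates of `∇φ × e = curlCLM(Dφ ⊗ e)` on the frame `eⱼ × e`;
* `inner_apply_curlCLM_smulRight` — the LAMB–LAGRANGE identity `⟪Lv, a×e⟫ = ⟪L(a×e), v⟫ + ⟪curl L, a⟫⟪v, e⟫ − ⟪curl L, e⟫⟪v, a⟫`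
  (`(L − Lᵀ)v = (curl L) × v` and Binet–Cauchy), `inner_apply_eq_sum_coord`;
* `curl_smul_const`, `isTestFunctionOn_curl_smul_const`, `fderiv_curl_smul_const_apply`, `divergence_curl_smul_const`,
  `fderiv_curl_smul_const_apply_self` (`D(curl(ψe))(x)[x] = curl((Dψ[x] − ψ)e)(x)`, Schwarz), `isTestFunctionOn_fderiv_apply_self`;
* `integral_inner_curl_smul_const` — **WEAK CURL TRANSFER** `∫⟪V, curl(φe)⟫ = ∫ φ⟪curlCLM∘G, e⟫` for `V` with whole-space weak gradient `G`;
* `isWeaklyDivFree_curlCLM` — the a.e. vorticity `curlCLM ∘ G` is weakly divergence free (`curl ∇ = 0`).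
[folklore; Evans2010 §5.2.1; MajdaBertozziCUP2002 §1.1–§1.2, §2.1 (2.5)]

WHAT THIS IS NOT: not NS, not E, not E1 itself — calculus; 19832 is OPEN.
-/

noncomputable section

-- flat `Theorems/<Route><Decl>…` files of one crux share the namespace of the crux (tree convention)
set_option linter.dupNamespace false

open MeasureTheory Set Filter Topology Metric Function TopologicalSpace
open scoped ENNReal NNReal RealInnerProductSpace ContDiff

namespace Summit.NavierStokesRegularity.NavierStokesRegularity.Theorems.PowerGaugeEulerLiouville.WeakEulerian

open Literature.Analysis Literature.Analysis.FunctionSpaces Literature.Analysis.FluidPDE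
open Summit.NavierStokesRegularity.NavierStokesRegularity.Theorems.PowerGaugeEulerLiouville

/-! ### Curl algebra on `ℝ³` in coordinates -/

section CurlAlgebra

/-- `⟪v, curlCLM(ℓ ⊗ e)⟫ = Σⱼ ⟪v, ℓ(eⱼ) • (eⱼ × e)⟫` — the rank-one curl `ℓ♯ × e` on the frame `eⱼ × e`. [folklore] -/
theorem inner_curlCLM_smulRight_eq (ℓ : EuclideanSpace ℝ (Fin 3) →L[ℝ] ℝ) (e v : EuclideanSpace ℝ (Fin 3)) :
    ⟪v, curlCLM (ℓ.smulRight e)⟫ =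
      ⟪v, ℓ (EuclideanSpace.single 0 1) • (WithLp.toLp 2 ![0, -(e 2), e 1] : EuclideanSpace ℝ (Fin 3))⟫ +
      ⟪v, ℓ (EuclideanSpace.single 1 1) • (WithLp.toLp 2 ![e 2, 0, -(e 0)] : EuclideanSpace ℝ (Fin 3))⟫ +
      ⟪v, ℓ (EuclideanSpace.single 2 1) • (WithLp.toLp 2 ![-(e 1), e 0, 0] : EuclideanSpace ℝ (Fin 3))⟫ := by
  obtain ⟨h0, h1, h2⟩ := WeakConfinedVorticity.curlCLM_apply_components (ℓ.smulRight e)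
  simp only [ContinuousLinearMap.smulRight_apply, PiLp.smul_apply, smul_eq_mul] at h0 h1 h2
  simp only [PiLp.inner_apply, Fin.sum_univ_three, RCLike.inner_apply, conj_trivial, h0, h1, h2, PiLp.smul_apply,
    smul_eq_mul, Matrix.cons_val_zero, Matrix.cons_val_one, Matrix.cons_val_two, Matrix.head_cons, Matrix.tail_cons]
  ring

/-- `Σⱼ ⟪L eⱼ, eⱼ × e⟫ = −⟪curlCLM L, e⟫` (`curl = Σⱼ eⱼ × ∂ⱼ`). [folklore] -/
theorem sum_inner_apply_crossBasis_eq (L : EuclideanSpace ℝ (Fin 3) →L[ℝ] EuclideanSpace ℝ (Fin 3)) (e : EuclideanSpace ℝ (Fin 3)) :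
    ⟪L (EuclideanSpace.single 0 1), (WithLp.toLp 2 ![0, -(e 2), e 1] : EuclideanSpace ℝ (Fin 3))⟫ +
      ⟪L (EuclideanSpace.single 1 1), (WithLp.toLp 2 ![e 2, 0, -(e 0)] : EuclideanSpace ℝ (Fin 3))⟫ +
      ⟪L (EuclideanSpace.single 2 1), (WithLp.toLp 2 ![-(e 1), e 0, 0] : EuclideanSpace ℝ (Fin 3))⟫ =
      -⟪curlCLM L, e⟫ := by
  obtain ⟨h0, h1, h2⟩ := WeakConfinedVorticity.curlCLM_apply_components L
  simp only [PiLp.inner_apply, Fin.sum_univ_three, RCLike.inner_apply, conj_trivial, h0, h1, h2,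
    Matrix.cons_val_zero, Matrix.cons_val_one, Matrix.cons_val_two, Matrix.head_cons, Matrix.tail_cons]
  ring

/-- Coordinates of `L v`: `(L v) i = Σⱼ v j · (L eⱼ) i`. [folklore] -/
theorem clm_apply_coord (L : EuclideanSpace ℝ (Fin 3) →L[ℝ] EuclideanSpace ℝ (Fin 3)) (v : EuclideanSpace ℝ (Fin 3)) (i : Fin 3) :
    L v i = v 0 * L (EuclideanSpace.single 0 1) i + v 1 * L (EuclideanSpace.single 1 1) i + v 2 * L (EuclideanSpace.single 2 1) i := by
  have hv : v = ∑ j, v j • EuclideanSpace.single j (1 : ℝ) := by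
    conv_lhs => rw [← (EuclideanSpace.basisFun (Fin 3) ℝ).sum_repr v]
    simp [EuclideanSpace.basisFun_apply]
  conv_lhs => rw [hv]
  simp only [Fin.sum_univ_three, map_add, map_smul, PiLp.add_apply, PiLp.smul_apply, smul_eq_mul]

/-- Coordinates of a covector: `ℓ v = Σⱼ v j · ℓ(eⱼ)`. [folklore] -/
theorem dual_apply_coord (ℓ : EuclideanSpace ℝ (Fin 3) →L[ℝ] ℝ) (v : EuclideanSpace ℝ (Fin 3)) :
    ℓ v = v 0 * ℓ (EuclideanSpace.single 0 1) + v 1 * ℓ (EuclideanSpace.single 1 1) + v 2 * ℓ (EuclideanSpace.single 2 1) := by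
  have hv : v = ∑ j, v j • EuclideanSpace.single j (1 : ℝ) := by
    conv_lhs => rw [← (EuclideanSpace.basisFun (Fin 3) ℝ).sum_repr v]
    simp [EuclideanSpace.basisFun_apply]
  conv_lhs => rw [hv]
  simp only [Fin.sum_univ_three, map_add, map_smul, smul_eq_mul]

/-- `⟪v, L w⟫ = Σᵢ w i · ⟪v, L eᵢ⟫`. [folklore] -/
theorem inner_apply_eq_sum_coord (L : EuclideanSpace ℝ (Fin 3) →L[ℝ] EuclideanSpace ℝ (Fin 3)) (v w : EuclideanSpace ℝ (Fin 3)) :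
    ⟪v, L w⟫ = w 0 * ⟪v, L (EuclideanSpace.single 0 1)⟫ + w 1 * ⟪v, L (EuclideanSpace.single 1 1)⟫ +
      w 2 * ⟪v, L (EuclideanSpace.single 2 1)⟫ := by
  have hw : w = ∑ j, w j • EuclideanSpace.single j (1 : ℝ) := by
    conv_lhs => rw [← (EuclideanSpace.basisFun (Fin 3) ℝ).sum_repr w]
    simp [EuclideanSpace.basisFun_apply]
  conv_lhs => rw [hw]
  simp only [Fin.sum_univ_three, map_add, map_smul, inner_add_right, real_inner_smul_right]

/-- **THE LAMB–LAGRANGE IDENTITY.**  For a linear map `L` on `ℝ³`, a covector `ℓ` and vectors `v, e`: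
`⟪L v, curlCLM(ℓ ⊗ e)⟫ = ⟪L(curlCLM(ℓ ⊗ e)), v⟫ + ℓ(curlCLM L)·⟪v, e⟫ − ⟪curlCLM L, e⟫·ℓ(v)`, i.e. with `a = ℓ♯`, `ω = curl L`:
`⟪Lv, a×e⟫ − ⟪Lᵀv, a×e⟫ = ⟪ω×v, a×e⟫ = ⟪ω,a⟫⟪v,e⟫ − ⟪ω,e⟫⟪v,a⟫` (the antisymmetric part of a Jacobian acts by its curl; Binet–Cauchy).
A polynomial identity in the entries. [folklore; MajdaBertozziCUP2002 §1.2 eqs. (1.22)–(1.24)] -/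
theorem inner_apply_curlCLM_smulRight (L : EuclideanSpace ℝ (Fin 3) →L[ℝ] EuclideanSpace ℝ (Fin 3)) (ℓ : EuclideanSpace ℝ (Fin 3) →L[ℝ] ℝ)
    (v e : EuclideanSpace ℝ (Fin 3)) :
    ⟪L v, curlCLM (ℓ.smulRight e)⟫ =
      ⟪L (curlCLM (ℓ.smulRight e)), v⟫ + ℓ (curlCLM L) * ⟪v, e⟫ - ⟪curlCLM L, e⟫ * ℓ v := by
  obtain ⟨h0, h1, h2⟩ := WeakConfinedVorticity.curlCLM_apply_components (ℓ.smulRight e)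
  simp only [ContinuousLinearMap.smulRight_apply, PiLp.smul_apply, smul_eq_mul] at h0 h1 h2
  obtain ⟨k0, k1, k2⟩ := WeakConfinedVorticity.curlCLM_apply_components L
  rw [dual_apply_coord ℓ (curlCLM L), dual_apply_coord ℓ v]
  simp only [PiLp.inner_apply, Fin.sum_univ_three, RCLike.inner_apply, conj_trivial, h0, h1, h2, k0, k1, k2,
    clm_apply_coord L v, clm_apply_coord L (curlCLM (ℓ.smulRight e))]
  ring

end CurlAlgebra

/-! ### The curl test fields `curl(ψ•e)` -/

section CurlTest

variable {ψ : EuclideanSpace ℝ (Fin 3) → ℝ} {e : EuclideanSpace ℝ (Fin 3)}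

/-- `curl(ψ•e)(x) = curlCLM(Dψ(x) ⊗ e)` (`= ∇ψ × e`). [folklore] -/
theorem curl_smul_const (hψ : ContDiff ℝ ∞ ψ) (e x : EuclideanSpace ℝ (Fin 3)) :
    curl (fun y => ψ y • e) x = curlCLM ((fderiv ℝ ψ x).smulRight e) := by
  rw [curl_eq_curlCLM, fderiv_smul_const ((hψ.differentiable (by simp)) x)]

/-- `curl(ψ•e) = T ∘ Dψ` with the linear map `T = curlCLM ∘ (· ⊗ e)`. [folklore] -/
theorem curl_smul_const_eq_comp (hψ : ContDiff ℝ ∞ ψ) (e : EuclideanSpace ℝ (Fin 3)) :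
    curl (fun y => ψ y • e) =
      ⇑(curlCLM.comp ((ContinuousLinearMap.smulRightL ℝ (EuclideanSpace ℝ (Fin 3)) (EuclideanSpace ℝ (Fin 3))).flip e)) ∘ fderiv ℝ ψ := by
  funext x
  rw [curl_smul_const hψ]
  simp [ContinuousLinearMap.flip_apply]

/-- `curl(ψ•e)` is smooth. [folklore] -/
theorem contDiff_curl_smul_const (hψ : ContDiff ℝ ∞ ψ) (e : EuclideanSpace ℝ (Fin 3)) :
    ContDiff ℝ ∞ (curl (fun y => ψ y • e)) := by
  rw [curl_smul_const_eq_comp hψ]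
  exact (ContinuousLinearMap.contDiff _).comp (hψ.fderiv_right (m := ∞) (by simp))

/-- `support (curl(ψ•e)) ⊆ support Dψ`. [folklore] -/
theorem support_curl_smul_const_subset (hψ : ContDiff ℝ ∞ ψ) (e : EuclideanSpace ℝ (Fin 3)) :
    support (curl (fun y => ψ y • e)) ⊆ support (fderiv ℝ ψ) := by
  intro x hx
  rw [mem_support] at hx ⊢
  intro h
  apply hx
  rw [curl_smul_const hψ, h, ContinuousLinearMap.zero_smulRight, map_zero]

/-- `tsupport (curl(ψ•e)) ⊆ tsupport ψ`. [folklore] -/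
theorem tsupport_curl_smul_const_subset (hψ : ContDiff ℝ ∞ ψ) (e : EuclideanSpace ℝ (Fin 3)) :
    tsupport (curl (fun y => ψ y • e)) ⊆ tsupport ψ :=
  (closure_mono (support_curl_smul_const_subset hψ e)).trans (tsupport_fderiv_subset ℝ)

/-- `curl(ψ•e)` is a test field when `ψ` is a test function. [folklore] -/
theorem isTestFunctionOn_curl_smul_const (hψ : IsTestFunctionOn (⊤ : Opens (EuclideanSpace ℝ (Fin 3))) ψ) (e : EuclideanSpace ℝ (Fin 3)) :
    IsTestFunctionOn (⊤ : Opens (EuclideanSpace ℝ (Fin 3))) (curl (fun y => ψ y • e)) :=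
  ⟨contDiff_curl_smul_const hψ.contDiff e,
    (hψ.hasCompactSupport.fderiv (𝕜 := ℝ)).mono (support_curl_smul_const_subset hψ.contDiff e), by simp⟩

/-- `D(curl(ψ•e))(x)[w] = curlCLM(D²ψ(x)[w] ⊗ e)`. [folklore] -/
theorem hasFDerivAt_curl_smul_const (hψ : ContDiff ℝ ∞ ψ) (e x : EuclideanSpace ℝ (Fin 3)) :
    HasFDerivAt (curl (fun y => ψ y • e))
      ((curlCLM.comp ((ContinuousLinearMap.smulRightL ℝ (EuclideanSpace ℝ (Fin 3)) (EuclideanSpace ℝ (Fin 3))).flip e)).comp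
        (fderiv ℝ (fderiv ℝ ψ) x)) x := by
  have hD : HasFDerivAt (fderiv ℝ ψ) (fderiv ℝ (fderiv ℝ ψ) x) x :=
    ((hψ.fderiv_right (m := ∞) (by simp)).differentiable (by simp) x).hasFDerivAt
  rw [curl_smul_const_eq_comp hψ]
  exact (ContinuousLinearMap.hasFDerivAt _).comp x hD

/-- `D(curl(ψ•e))(x)[w] = curlCLM(D²ψ(x)[w] ⊗ e)`, applied form. [folklore] -/
theorem fderiv_curl_smul_const_apply (hψ : ContDiff ℝ ∞ ψ) (e x w : EuclideanSpace ℝ (Fin 3)) :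
    fderiv ℝ (curl (fun y => ψ y • e)) x w = curlCLM ((fderiv ℝ (fderiv ℝ ψ) x w).smulRight e) := by
  rw [(hasFDerivAt_curl_smul_const hψ e x).fderiv]
  simp [ContinuousLinearMap.flip_apply]

/-- `div(curl(ψ•e)) = 0`. [folklore; MajdaBertozziCUP2002 §1.1] -/
theorem divergence_curl_smul_const (hψ : ContDiff ℝ ∞ ψ) (e x : EuclideanSpace ℝ (Fin 3)) :
    VectorCalculus.divergence (curl (fun y => ψ y • e)) x = 0 :=
  divergence_curl_eq_zero_holds (fun y => ψ y • e) ((hψ.of_le (by norm_cast)).smul contDiff_const) x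

/-- The radial derivative test function `ψ₁(x) = Dψ(x)[x]` is a test function. [folklore] -/
theorem isTestFunctionOn_fderiv_apply_self (hψ : IsTestFunctionOn (⊤ : Opens (EuclideanSpace ℝ (Fin 3))) ψ) :
    IsTestFunctionOn (⊤ : Opens (EuclideanSpace ℝ (Fin 3))) (fun x => fderiv ℝ ψ x x) := by
  refine ⟨(hψ.contDiff.fderiv_right (m := ∞) (by simp)).clm_apply contDiff_id, ?_, by simp⟩
  refine (hψ.hasCompactSupport.fderiv (𝕜 := ℝ)).mono fun x hx => ?_
  rw [mem_support] at hx ⊢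
  intro h; exact hx (by rw [h, _root_.zero_apply])

/-- `Dψ₁(x)[w] = D²ψ(x)[w][x] + Dψ(x)[w]` for `ψ₁(x) = Dψ(x)[x]`. [folklore] -/
theorem fderiv_fderiv_apply_self (hψ : ContDiff ℝ ∞ ψ) (x w : EuclideanSpace ℝ (Fin 3)) :
    fderiv ℝ (fun y => fderiv ℝ ψ y y) x w = fderiv ℝ (fderiv ℝ ψ) x w x + fderiv ℝ ψ x w := by
  have hD : HasFDerivAt (fderiv ℝ ψ) (fderiv ℝ (fderiv ℝ ψ) x) x :=
    ((hψ.fderiv_right (m := ∞) (by simp)).differentiable (by simp) x).hasFDerivAt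
  have h : HasFDerivAt (fun y => fderiv ℝ ψ y y)
      ((fderiv ℝ ψ x).comp (ContinuousLinearMap.id ℝ (EuclideanSpace ℝ (Fin 3))) + (fderiv ℝ (fderiv ℝ ψ) x).flip x) x :=
    hD.clm_apply (hasFDerivAt_id x)
  rw [h.fderiv, _root_.add_apply, ContinuousLinearMap.comp_apply, ContinuousLinearMap.id_apply,
    ContinuousLinearMap.flip_apply, add_comm]

/-- **`D(curl(ψ•e))(x)[x] = curl((ψ₁ − ψ)•e)(x)`**, `ψ₁(x) = Dψ(x)[x]`: `(x·∇)curl Φ = curl((x·∇)Φ − Φ)` for `Φ = ψ e` (Schwarz). [folklore] -/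
theorem fderiv_curl_smul_const_apply_self (hψ : ContDiff ℝ ∞ ψ) (e x : EuclideanSpace ℝ (Fin 3)) :
    fderiv ℝ (curl (fun y => ψ y • e)) x x = curl (fun y => (fderiv ℝ ψ y y - ψ y) • e) x := by
  have hψ₁ : ContDiff ℝ ∞ (fun y => fderiv ℝ ψ y y) := (hψ.fderiv_right (m := ∞) (by simp)).clm_apply contDiff_id
  have hsymm : ∀ v w, fderiv ℝ (fderiv ℝ ψ) x v w = fderiv ℝ (fderiv ℝ ψ) x w v :=
    ((hψ.of_le (by norm_cast) : ContDiff ℝ 2 ψ).contDiffAt.isSymmSndFDerivAt (by simp))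
  rw [fderiv_curl_smul_const_apply hψ, curl_smul_const (hψ₁.sub hψ)]
  congr 1
  have hd : fderiv ℝ (fun y => fderiv ℝ ψ y y - ψ y) x = fderiv ℝ (fderiv ℝ ψ) x x := by
    rw [fderiv_fun_sub ((hψ₁.differentiable (by simp)) x) ((hψ.differentiable (by simp)) x)]
    ext w
    rw [_root_.sub_apply, fderiv_fderiv_apply_self hψ, hsymm w x]
    ring
  rw [hd]

end CurlTest

/-! ### The weak curl transfer and the weak divergence-freeness of the vorticity -/

section WeakCurl

variable {V : EuclideanSpace ℝ (Fin 3) → EuclideanSpace ℝ (Fin 3)}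
  {G : EuclideanSpace ℝ (Fin 3) → EuclideanSpace ℝ (Fin 3) →L[ℝ] EuclideanSpace ℝ (Fin 3)}

/-- **WEAK CURL TRANSFER.**  If `V` has the whole-space weak gradient `G`, then for every scalar test function `φ` and every `e`,
`∫ ⟪V, curl(φ•e)⟫ = ∫ φ ⟪curlCLM ∘ G, e⟫` (`curl(φe) = Σⱼ ∂ⱼφ (eⱼ × e)`, three integrations by parts, `Σⱼ⟪G eⱼ, eⱼ × e⟫ = −⟪curl G, e⟫`).
[folklore; Evans2010 §5.2.1] -/
theorem integral_inner_curl_smul_const (hVG : HasWeakFDerivOn (⊤ : Opens (EuclideanSpace ℝ (Fin 3))) volume V G)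
    {φ : EuclideanSpace ℝ (Fin 3) → ℝ} (hφ : IsTestFunctionOn (⊤ : Opens (EuclideanSpace ℝ (Fin 3))) φ) (e : EuclideanSpace ℝ (Fin 3)) :
    ∫ x, ⟪V x, curl (fun y => φ y • e) x⟫ = ∫ x, φ x * ⟪curlCLM (G x), e⟫ := by
  set c0 : EuclideanSpace ℝ (Fin 3) := WithLp.toLp 2 ![0, -(e 2), e 1] with hc0
  set c1 : EuclideanSpace ℝ (Fin 3) := WithLp.toLp 2 ![e 2, 0, -(e 0)] with hc1
  set c2 : EuclideanSpace ℝ (Fin 3) := WithLp.toLp 2 ![-(e 1), e 0, 0] with hc2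
  have hpt : ∀ x, ⟪V x, curl (fun y => φ y • e) x⟫ =
      ⟪V x, fderiv ℝ φ x (EuclideanSpace.single 0 1) • c0⟫ + ⟪V x, fderiv ℝ φ x (EuclideanSpace.single 1 1) • c1⟫ +
        ⟪V x, fderiv ℝ φ x (EuclideanSpace.single 2 1) • c2⟫ := fun x => by
    rw [curl_smul_const hφ.contDiff, inner_curlCLM_smulRight_eq]
  have i0 := WeakConfinedVorticity.integrable_inner_fderiv_smul hVG hφ (EuclideanSpace.single 0 1) c0
  have i1 := WeakConfinedVorticity.integrable_inner_fderiv_smul hVG hφ (EuclideanSpace.single 1 1) c1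
  have i2 := WeakConfinedVorticity.integrable_inner_fderiv_smul hVG hφ (EuclideanSpace.single 2 1) c2
  have j0 := WeakConfinedVorticity.integrable_mul_inner_apply hVG hφ (EuclideanSpace.single 0 1) c0
  have j1 := WeakConfinedVorticity.integrable_mul_inner_apply hVG hφ (EuclideanSpace.single 1 1) c1
  have j2 := WeakConfinedVorticity.integrable_mul_inner_apply hVG hφ (EuclideanSpace.single 2 1) c2
  simp_rw [hpt]
  rw [integral_add ?_ i2, integral_add i0 i1,
    WeakConfinedVorticity.integral_inner_fderiv_smul_eq hVG hφ, WeakConfinedVorticity.integral_inner_fderiv_smul_eq hVG hφ,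
    WeakConfinedVorticity.integral_inner_fderiv_smul_eq hVG hφ]
  swap; · exact i0.add i1
  have hrhs : ∫ x, φ x * ⟪curlCLM (G x), e⟫ =
      -((∫ x, φ x * ⟪G x (EuclideanSpace.single 0 1), c0⟫) + (∫ x, φ x * ⟪G x (EuclideanSpace.single 1 1), c1⟫) +
        ∫ x, φ x * ⟪G x (EuclideanSpace.single 2 1), c2⟫) := by
    rw [← integral_add j0 j1, ← integral_add ?_ j2, ← integral_neg]
    swap; · exact j0.add j1
    refine integral_congr_ae (Eventually.of_forall fun x => ?_)
    have h := sum_inner_apply_crossBasis_eq (G x) e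
    linear_combination (φ x) * h
  rw [hrhs]
  ring

/-- **The a.e. vorticity of a field with a weak gradient is weakly divergence free**: `∫ ⟪curlCLM ∘ G, ∇θ⟫ = 0` for every test `θ`
(`∇θ = Σⱼ ∂ⱼθ eⱼ`, weak curl transfer with `φ = ∂ⱼθ`, and `Σⱼ curl(∂ⱼθ eⱼ) = curl ∇θ = 0` by Schwarz). [folklore; MajdaBertozziCUP2002 §1.2] -/
theorem isWeaklyDivFree_curlCLM (hVG : HasWeakFDerivOn (⊤ : Opens (EuclideanSpace ℝ (Fin 3))) volume V G) :
    IsWeaklyDivFree (fun x => curlCLM (G x)) := by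
  intro θ hθ
  have hVl : LocallyIntegrable V volume := locallyIntegrableOn_univ.1 (by
    simpa only [Opens.coe_top] using hVG.locallyIntegrableOn)
  have hGl : LocallyIntegrable G volume := locallyIntegrableOn_univ.1 (by
    simpa only [Opens.coe_top] using hVG.locallyIntegrableOn_deriv)
  have hΩl : LocallyIntegrable (fun x => curlCLM (G x)) volume :=
    locallyIntegrableOn_univ.1 (curlCLM.locallyIntegrableOn_comp (locallyIntegrableOn_univ.2 hGl))
  -- the partial derivatives of `θ` are test functions
  have hθj : ∀ j : Fin 3, IsTestFunctionOn (⊤ : Opens (EuclideanSpace ℝ (Fin 3))) (fun x => fderiv ℝ θ x (EuclideanSpace.single j 1)) :=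
    fun j => ⟨(hθ.contDiff.fderiv_right (m := ∞) (by simp)).clm_apply contDiff_const,
      hθ.hasCompactSupport.fderiv_apply (𝕜 := ℝ) _, by simp⟩
  have hT : ∀ j : Fin 3, IsTestFunctionOn (⊤ : Opens (EuclideanSpace ℝ (Fin 3)))
      (fun x => fderiv ℝ θ x (EuclideanSpace.single j 1) • EuclideanSpace.single j (1 : ℝ)) :=
    fun j => ⟨(hθj j).contDiff.smul contDiff_const, (hθj j).hasCompactSupport.smul_right, by simp⟩
  -- `⟪Ω, ∇θ⟫ = Σⱼ ⟪Ω, ∂ⱼθ • eⱼ⟫`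
  have hgrad : ∀ x, ⟪curlCLM (G x), gradient θ x⟫ =
      ⟪curlCLM (G x), fderiv ℝ θ x (EuclideanSpace.single 0 1) • EuclideanSpace.single 0 (1 : ℝ)⟫ +
        ⟪curlCLM (G x), fderiv ℝ θ x (EuclideanSpace.single 1 1) • EuclideanSpace.single 1 (1 : ℝ)⟫ +
        ⟪curlCLM (G x), fderiv ℝ θ x (EuclideanSpace.single 2 1) • EuclideanSpace.single 2 (1 : ℝ)⟫ := by
    intro x
    have hc : ∀ j : Fin 3, gradient θ x j = fderiv ℝ θ x (EuclideanSpace.single j 1) := fun j => by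
      have h1 : ⟪gradient θ x, EuclideanSpace.single j (1 : ℝ)⟫ = gradient θ x j := by
        simp only [EuclideanSpace.inner_single_right, one_mul, RCLike.conj_to_real]
      rw [← h1, gradient, InnerProductSpace.toDual_symm_apply]
    have hv : gradient θ x = ∑ j, gradient θ x j • EuclideanSpace.single j (1 : ℝ) := by
      conv_lhs => rw [← (EuclideanSpace.basisFun (Fin 3) ℝ).sum_repr (gradient θ x)]
      simp [EuclideanSpace.basisFun_apply]
    rw [hv]
    simp only [Fin.sum_univ_three, inner_add_right, hc]
  -- `Σⱼ curl(∂ⱼθ • eⱼ) = 0` pointwise (Schwarz)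
  have hsymm : ∀ x v w, fderiv ℝ (fderiv ℝ θ) x v w = fderiv ℝ (fderiv ℝ θ) x w v := fun x =>
    ((hθ.contDiff.of_le (by norm_cast) : ContDiff ℝ 2 θ).contDiffAt.isSymmSndFDerivAt (by simp))
  have hDj : ∀ (j : Fin 3) x, fderiv ℝ (fun y => fderiv ℝ θ y (EuclideanSpace.single j 1)) x =
      (fderiv ℝ (fderiv ℝ θ) x).flip (EuclideanSpace.single j 1) := by
    intro j x
    have hD : HasFDerivAt (fderiv ℝ θ) (fderiv ℝ (fderiv ℝ θ) x) x :=
      ((hθ.contDiff.fderiv_right (m := ∞) (by simp)).differentiable (by simp) x).hasFDerivAt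
    have h := hD.clm_apply (hasFDerivAt_const (EuclideanSpace.single j (1 : ℝ)) x)
    rw [h.fderiv]
    ext w
    simp [ContinuousLinearMap.flip_apply]
  have hzero : ∀ x, curl (fun y => fderiv ℝ θ y (EuclideanSpace.single 0 1) • EuclideanSpace.single 0 (1 : ℝ)) x +
      curl (fun y => fderiv ℝ θ y (EuclideanSpace.single 1 1) • EuclideanSpace.single 1 (1 : ℝ)) x +
      curl (fun y => fderiv ℝ θ y (EuclideanSpace.single 2 1) • EuclideanSpace.single 2 (1 : ℝ)) x = 0 := by
    intro x
    rw [curl_smul_const (hθj 0).contDiff, curl_smul_const (hθj 1).contDiff, curl_smul_const (hθj 2).contDiff,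
      hDj 0 x, hDj 1 x, hDj 2 x, ← map_add, ← map_add]
    set M := fderiv ℝ (fderiv ℝ θ) x with hM
    set S : EuclideanSpace ℝ (Fin 3) →L[ℝ] EuclideanSpace ℝ (Fin 3) :=
      (M.flip (EuclideanSpace.single 0 1)).smulRight (EuclideanSpace.single 0 (1 : ℝ)) +
        (M.flip (EuclideanSpace.single 1 1)).smulRight (EuclideanSpace.single 1 (1 : ℝ)) +
        (M.flip (EuclideanSpace.single 2 1)).smulRight (EuclideanSpace.single 2 (1 : ℝ)) with hS
    have hSe : ∀ k i : Fin 3, S (EuclideanSpace.single k 1) i = M (EuclideanSpace.single k 1) (EuclideanSpace.single i 1) := by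
      intro k i
      simp only [hS, _root_.add_apply, ContinuousLinearMap.smulRight_apply, ContinuousLinearMap.flip_apply,
        PiLp.add_apply, PiLp.smul_apply, smul_eq_mul]
      fin_cases i <;> simp
    obtain ⟨a0, a1, a2⟩ := WeakConfinedVorticity.curlCLM_apply_components S
    rw [hSe, hSe] at a0 a1 a2
    ext i
    fin_cases i
    · simp only [Fin.zero_eta] at a0 ⊢
      rw [PiLp.zero_apply, a0, hsymm x (EuclideanSpace.single 1 1) (EuclideanSpace.single 2 1), sub_self]
    · simp only [Fin.mk_one] at a1 ⊢
      rw [PiLp.zero_apply, a1, hsymm x (EuclideanSpace.single 2 1) (EuclideanSpace.single 0 1), sub_self]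
    · simp only [Fin.reduceFinMk] at a2 ⊢
      rw [PiLp.zero_apply, a2, hsymm x (EuclideanSpace.single 0 1) (EuclideanSpace.single 1 1), sub_self]
  -- integrate
  have hA : ∀ j : Fin 3, Integrable (fun x => ⟪curlCLM (G x),
      fderiv ℝ θ x (EuclideanSpace.single j 1) • EuclideanSpace.single j (1 : ℝ)⟫) volume := fun j =>
    Literature.Analysis.FluidPDE.integrable_inner_of_locallyIntegrable_of_hasCompactSupport hΩl (hT j).contDiff.continuous
      (hT j).hasCompactSupport
  have hB : ∀ j : Fin 3, Integrable (fun x => ⟪V x,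
      curl (fun y => fderiv ℝ θ y (EuclideanSpace.single j 1) • EuclideanSpace.single j (1 : ℝ)) x⟫) volume := fun j =>
    Literature.Analysis.FluidPDE.integrable_inner_of_locallyIntegrable_of_hasCompactSupport hVl
      (isTestFunctionOn_curl_smul_const (hθj j) _).contDiff.continuous (isTestFunctionOn_curl_smul_const (hθj j) _).hasCompactSupport
  have hAB : ∀ j : Fin 3, ∫ x, ⟪curlCLM (G x), fderiv ℝ θ x (EuclideanSpace.single j 1) • EuclideanSpace.single j (1 : ℝ)⟫ =
      ∫ x, ⟪V x, curl (fun y => fderiv ℝ θ y (EuclideanSpace.single j 1) • EuclideanSpace.single j (1 : ℝ)) x⟫ := fun j => by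
    rw [integral_inner_curl_smul_const hVG (hθj j)]
    refine integral_congr_ae (Eventually.of_forall fun x => ?_)
    simp only [real_inner_smul_right]
  calc ∫ x, ⟪curlCLM (G x), gradient θ x⟫
      = ∫ x, (⟪curlCLM (G x), fderiv ℝ θ x (EuclideanSpace.single 0 1) • EuclideanSpace.single 0 (1 : ℝ)⟫ +
          ⟪curlCLM (G x), fderiv ℝ θ x (EuclideanSpace.single 1 1) • EuclideanSpace.single 1 (1 : ℝ)⟫ +
          ⟪curlCLM (G x), fderiv ℝ θ x (EuclideanSpace.single 2 1) • EuclideanSpace.single 2 (1 : ℝ)⟫) :=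
        integral_congr_ae (Eventually.of_forall hgrad)
    _ = (∫ x, ⟪V x, curl (fun y => fderiv ℝ θ y (EuclideanSpace.single 0 1) • EuclideanSpace.single 0 (1 : ℝ)) x⟫) +
          (∫ x, ⟪V x, curl (fun y => fderiv ℝ θ y (EuclideanSpace.single 1 1) • EuclideanSpace.single 1 (1 : ℝ)) x⟫) +
          ∫ x, ⟪V x, curl (fun y => fderiv ℝ θ y (EuclideanSpace.single 2 1) • EuclideanSpace.single 2 (1 : ℝ)) x⟫ := by
        rw [integral_add ?_ (hA 2), integral_add (hA 0) (hA 1), hAB 0, hAB 1, hAB 2]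
        exact (hA 0).add (hA 1)
    _ = ∫ x, ⟪V x, curl (fun y => fderiv ℝ θ y (EuclideanSpace.single 0 1) • EuclideanSpace.single 0 (1 : ℝ)) x +
          curl (fun y => fderiv ℝ θ y (EuclideanSpace.single 1 1) • EuclideanSpace.single 1 (1 : ℝ)) x +
          curl (fun y => fderiv ℝ θ y (EuclideanSpace.single 2 1) • EuclideanSpace.single 2 (1 : ℝ)) x⟫ := by
        rw [← integral_add (hB 0) (hB 1), ← integral_add ?_ (hB 2)]
        swap; · exact (hB 0).add (hB 1)
        refine integral_congr_ae (Eventually.of_forall fun x => ?_)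
        simp only [inner_add_right]
    _ = 0 := by simp [hzero]

end WeakCurl

end Summit.NavierStokesRegularity.NavierStokesRegularity.Theorems.PowerGaugeEulerLiouville.WeakEulerian

end
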